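import Summits.CriticalPhenomena.LaceExpansionHighD.TrailCountN13X1
import Literature.Probability.FitznerVanDerHofstad2017.TrailClassMaxD11N13
import HarnessLib

/-!
# Trail class maximum at `d = 11`, `L = 13`, closed form: `a_13(v) ≤ 1475645364480 = a_13(e₁)` for all `v ≠ 0`

Capstone of `Literature/Probability/FitznerVanDerHofstad2017/TrailClassMaxD11N13` (the 210 far classes by their
non-backtracking majorants, near count supplied) with the near count certified in this directory
(`TrailCountN13X1.card_trailWordsTo_n13_x1_d11 : a_13(e₁) = 1475645364480` at `d = 11`).  The class-maximum statement
`CM(13)` presumed by Fitzner–van der Hofstad's notebook `Percolation.nb` cell 12 (`Bound[OpenBubble,m,s]`, the supremum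
over end points taken over the near classes only; EJP 22 (2017), arXiv:1506.07977) as a kernel theorem, and the
hypothesis-free exact majorant `a_L(v) ≤ trailMajorantD11Exact L` (`v ≠ 0`, all `L`).
Pure combinatorics; axioms `propext`, `Classical.choice`, `Quot.sound` only.
-/

namespace Summit.CriticalPhenomena.LaceExpansionHighD

open Literature.Probability.FitznerVanDerHofstad2017 Literature.Probability.LatticeModels

/-- **`CM(13)` at `d = 11`**: `a_13(v) ≤ a_13(e₁) = 1475645364480` for every end point `v ≠ 0`.
[cite: FitznerVanDerHofstad2017, notebook Percolation.nb cell 12 (`Bound[OpenBubble,m,s]`, classes {1}, {2} of `nrBAW`)] -/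
theorem card_trailWordsTo_le_classMax_n13_d11 {v : Site 11} (hv : v ≠ 0) :
    (trailWordsTo 11 13 v).card ≤ 1475645364480 :=
  card_trailWordsTo_le_classMax_d11_n13 card_trailWordsTo_n13_x1_d11.le hv

/-- `CM(13)` in comparison form: `a_13(v) ≤ a_13(e₁)` for every `v ≠ 0`.
[cite: FitznerVanDerHofstad2017, notebook Percolation.nb cell 12 (`Bound[OpenBubble,m,s]`, classes {1}, {2} of `nrBAW`)] -/
theorem card_trailWordsTo_le_card_trailWordsTo_e1_n13_d11 {v : Site 11} (hv : v ≠ 0) :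
    (trailWordsTo 11 13 v).card ≤ (trailWordsTo 11 13 (siteOfList [1] 11)).card :=
  (card_trailWordsTo_le_classMax_n13_d11 hv).trans_eq card_trailWordsTo_n13_x1_d11.symm

/-- **Exact end-point majorant at `d = 11`, hypothesis-free**: `a_L(v) ≤ trailMajorantD11Exact L` for every `L` and
every `v ≠ 0` (the Literature-side `card_trailWordsTo_le_trailMajorantD11Exact` with its near-count hypothesis
discharged by `card_trailWordsTo_n13_x1_d11`) — the exact `N₁` of the `x ≠ 0` slot consumers at `d = 11`.
[cite: FitznerVanDerHofstad2017, notebook Percolation.nb cell 12 (`Bound[OpenBubble,m,s]`, classes {1}, {2} of `nrBAW`)] -/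
theorem card_trailWordsTo_le_trailMajorantD11Exact_d11 (L : ℕ) {v : Site 11} (hv : v ≠ 0) :
    (trailWordsTo 11 L v).card ≤ trailMajorantD11Exact L :=
  card_trailWordsTo_le_trailMajorantD11Exact card_trailWordsTo_n13_x1_d11.le L hv

/-- Consumer form (`hN₁ : ∀ L v, v ≠ 0 → #trailWordsTo 11 L v ≤ N₁ L` with `N₁ := trailMajorantD11Exact`).
[cite: FitznerVanDerHofstad2017, notebook Percolation.nb cell 12 (`Bound[OpenBubble,m,s]`, classes {1}, {2} of `nrBAW`)] -/
theorem forall_card_trailWordsTo_le_trailMajorantD11Exact_d11 :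
    ∀ L (v : Site 11), v ≠ 0 → (trailWordsTo 11 L v).card ≤ trailMajorantD11Exact L :=
  fun L _ hv => card_trailWordsTo_le_trailMajorantD11Exact_d11 L hv

end Summit.CriticalPhenomena.LaceExpansionHighD
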